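import Summits.CriticalPhenomena.Ising3DConformalLimit.Theorems.SynchronousCouplingRotationJoiningIsotropyConstrainedMoment
import Summits.CriticalPhenomena.Ising3DConformalLimit.Theorems.SynchronousCouplingRotationJoiningIsotropyFourPoint
import Summits.CriticalPhenomena.Ising3DConformalLimit.Theorems.SynchronousCouplingRotationJoiningTiltedTransferTools
import HarnessLib

/-!
# Route `SynchronousCoupling`, crux `RotationJoining` (stmt-CriticalPhenomena-18763), line `SketchIdeator2` (reshape 2) —
# near-field control: constrained smeared correlators are small (lead's tools for `stub_isotropyTransfer`)

* `sum_filter_exists_pair_le` — union bound: a sum of non-negative terms over configurations having SOME constrained pair is at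
  most the sum over ordered pairs `(a, b)` of the sums over configurations constrained at `(a, b)`.
* (`E_μ[B(S)²] = Σ_{x,y∈S} ⟨σ₀σ_{y−x}⟩_{β_c}` is `integral_blockSum_sq` of the tilted-transfer tools file.)
* `constrainedSum_bound` — for cells `Pₗ` of size `≤ Λ`, row sums `≤ U` on every cell, constrained row sums `≤ u` and constrained
  pairs `C ⊆ P_a × P_b`: `Σ_{y : (y_a,y_b) ∈ C} ⟨∏σ_{yₗ}⟩_{β_c} ≤ √((Λu)² + 2|C|U²) · √((2j)!/(2ʲj!) (ΛU)^j)`, `j = k − 2`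
  (`constrainedSum_le_sqrt_mul_sqrt` + `fourPoint_constrained_le` + `NewmanBlocks` at the plus state).
References: C. M. Newman, Z. Wahrsch. 33 (1975); M. Aizenman, H. Duminil-Copin, Ann. Math. 194 (2021) §6.3. No definitions, no sorry.
-/

noncomputable section

namespace Summit.CriticalPhenomena.Ising3DConformalLimit.Cruxes.RotationJoining.RateSplitting

open MeasureTheory Filter Literature.Probability.LatticeModels Finset
open scoped BigOperators

/-- **Union bound.** For non-negative `f` and relations `R a b` on configurations,
`Σ_{y : ∃ a ≠ b, R a b y} f y ≤ Σ_a Σ_b Σ_{y : a ≠ b ∧ R a b y} f y`. [folklore] -/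
theorem sum_filter_exists_pair_le {α : Type*} {k : ℕ} (s : Finset α) (R : Fin k → Fin k → α → Prop)
    [∀ a b y, Decidable (R a b y)] (f : α → ℝ) (hf : ∀ y ∈ s, 0 ≤ f y) :
    ∑ y ∈ s.filter (fun y => ∃ a b, a ≠ b ∧ R a b y), f y ≤
      ∑ a, ∑ b, ∑ y ∈ s.filter (fun y => a ≠ b ∧ R a b y), f y := by
  classical
  have hR : ∀ a b, ∑ y ∈ s.filter (fun y => a ≠ b ∧ R a b y), f y = ∑ y ∈ s, (if a ≠ b ∧ R a b y then f y else 0) :=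
    fun a b => Finset.sum_filter _ _
  simp_rw [hR]
  rw [Finset.sum_filter, Finset.sum_comm]
  simp_rw [Finset.sum_comm (s := (Finset.univ : Finset (Fin k))) (t := s)]
  refine Finset.sum_le_sum fun y hy => ?_
  have hnn : ∀ a' b', 0 ≤ (if a' ≠ b' ∧ R a' b' y then f y else 0) := fun a' b' => by
    split_ifs
    · exact hf y hy
    · exact le_rfl
  by_cases h : ∃ a b, a ≠ b ∧ R a b y
  · rw [if_pos h]
    obtain ⟨a, b, hab, hRy⟩ := h
    calc f y = (if a ≠ b ∧ R a b y then f y else 0) := by rw [if_pos ⟨hab, hRy⟩]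
      _ ≤ ∑ a', (if a' ≠ b ∧ R a' b y then f y else 0) :=
          Finset.single_le_sum (f := fun a' => if a' ≠ b ∧ R a' b y then f y else 0) (fun a' _ => hnn a' b)
            (Finset.mem_univ a)
      _ ≤ ∑ b', ∑ a', (if a' ≠ b' ∧ R a' b' y then f y else 0) :=
          Finset.single_le_sum (f := fun b' => ∑ a', (if a' ≠ b' ∧ R a' b' y then f y else 0))
            (fun b' _ => Finset.sum_nonneg fun a' _ => hnn a' b') (Finset.mem_univ b)
  · rw [if_neg h]
    exact Finset.sum_nonneg fun b' _ => Finset.sum_nonneg fun a' _ => hnn a' b'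

/-- **Constrained smeared correlators are small (near-field bound).** Assume `NewmanBlocks`. Let `Pₗ ⊆ ℤ³` (`l ∈ Fin k`) be
cells with `|Pₗ| ≤ Λ`, let `U ≥ 0` bound every two-point row sum over every cell (`Σ_{y ∈ Pₗ} ⟨σ_xσ_y⟩ ≤ U`), let `a ≠ b`,
`C ⊆ P_a × P_b` and let `u` bound the constrained row sums `Σ_{q : (p,q) ∈ C} ⟨σ_pσ_q⟩`, `p ∈ P_a`. Then
`Σ_{y ∈ ∏ Pₗ, (y_a,y_b) ∈ C} ⟨∏ₗ σ_{yₗ}⟩_{β_c} ≤ √((Λu)² + 2 |C| U²) · √((2j)!/(2ʲ j!) (ΛU)^j)`, `j = k − 2`.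
[cite: AizenmanDuminilCopinAnnals2021, arXiv:1912.07973 §6.3] -/
theorem constrainedSum_bound (hNB : NewmanBlocks) {k : ℕ} (P : Fin k → Finset (Site 3)) {a b : Fin k} (hab : a ≠ b)
    (C : Finset (Site 3 × Site 3)) (hC : C ⊆ P a ×ˢ P b) {Λ U u : ℝ} (hU0 : 0 ≤ U) (hu0 : 0 ≤ u)
    (hΛ : ∀ l, ((P l).card : ℝ) ≤ Λ)
    (hUrow : ∀ (l : Fin k) (x : Site 3), ∑ y ∈ P l, criticalTwoPoint 3 (y - x) ≤ U)
    (hu : ∀ p ∈ P a, ∑ q ∈ (P b).filter (fun q => (p, q) ∈ C), criticalTwoPoint 3 (q - p) ≤ u) :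
    ∑ y ∈ (Fintype.piFinset P).filter (fun y => (y a, y b) ∈ C), criticalCorr 3 k y ≤
      Real.sqrt ((Λ * u) ^ 2 + 2 * C.card * U ^ 2) *
        Real.sqrt (((2 * (k - 2)).factorial : ℝ) / (2 ^ (k - 2) * (k - 2).factorial) * (Λ * U) ^ (k - 2)) := by
  -- the plus state
  obtain ⟨μ, hμG, -, hcorr⟩ :=
    exists_plusMeasure_holds (d := 3) (β := criticalBeta 3) (h := (0 : ℝ)) (criticalBeta_nonneg 3)
  haveI : IsProbabilityMeasure μ := ((mem_isingGibbsMeasures_iff 3 _ 0 μ).1 hμG).isProbabilityMeasure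
  have hNBμ := hNB μ hμG
  -- second moments of the blocks
  have hW : ∀ l, ∫ σ, (blockSum (P l) σ) ^ 2 ∂μ ≤ Λ * U := by
    intro l
    rw [integral_blockSum_sq hcorr (P l)]
    calc ∑ x ∈ P l, ∑ y ∈ P l, criticalTwoPoint 3 (y - x) ≤ ∑ _x ∈ P l, U :=
          Finset.sum_le_sum fun x _ => hUrow l x
      _ = (P l).card * U := by rw [Finset.sum_const, nsmul_eq_mul]
      _ ≤ Λ * U := mul_le_mul_of_nonneg_right (hΛ l) hU0
  have h1 := constrainedSum_le_sqrt_mul_sqrt hcorr hNBμ P hab C hC hW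
  have h4 := fourPoint_constrained_le (P a) (P b) C hC hU0 (hUrow a) (hUrow b) hu
  refine h1.trans (mul_le_mul_of_nonneg_right (Real.sqrt_le_sqrt (h4.trans ?_)) (Real.sqrt_nonneg _))
  have h : ((P a).card : ℝ) * u ≤ Λ * u := mul_le_mul_of_nonneg_right (hΛ a) hu0
  have h0 : 0 ≤ ((P a).card : ℝ) * u := mul_nonneg (Nat.cast_nonneg _) hu0
  nlinarith [h, h0]

/-! ### Variants with base points restricted to the cells (appended by the lead, cycle 1) -/

/-- **The constrained four-point sum, base points in the cells.** As `fourPoint_constrained_le`, but the row-sum bound `U` is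
only required for base points lying in `Q_a ∪ Q_b` (which is all the proof uses). [cite: AizenmanDuminilCopinAnnals2021, arXiv:1912.07973 §6.3] -/
theorem fourPoint_constrained_le' (Qa Qb : Finset (Site 3)) (C : Finset (Site 3 × Site 3)) (hC : C ⊆ Qa ×ˢ Qb)
    {U u : ℝ} (hU0 : 0 ≤ U)
    (hUa : ∀ x, x ∈ Qa ∨ x ∈ Qb → ∑ y ∈ Qa, criticalTwoPoint 3 (y - x) ≤ U)
    (hUb : ∀ x, x ∈ Qa ∨ x ∈ Qb → ∑ y ∈ Qb, criticalTwoPoint 3 (y - x) ≤ U)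
    (hu : ∀ p ∈ Qa, ∑ q ∈ Qb.filter (fun q => (p, q) ∈ C), criticalTwoPoint 3 (q - p) ≤ u) :
    ∑ c ∈ C, ∑ c' ∈ C, criticalCorr 3 4 ![c.1, c.2, c'.1, c'.2] ≤ (Qa.card * u) ^ 2 + 2 * C.card * U ^ 2 := by
  classical
  have hG : ∀ z, 0 ≤ criticalTwoPoint 3 z := criticalTwoPoint_nonneg'
  have hmem : ∀ c ∈ C, c.1 ∈ Qa ∧ c.2 ∈ Qb := fun c hc => Finset.mem_product.1 (hC hc)
  have hT : ∑ c ∈ C, criticalTwoPoint 3 (c.2 - c.1) ≤ Qa.card * u := by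
    rw [sum_pairs_eq_sum_fibres Qa Qb C hC (fun c => criticalTwoPoint 3 (c.2 - c.1))]
    calc ∑ p ∈ Qa, ∑ q ∈ Qb.filter (fun q => (p, q) ∈ C), criticalTwoPoint 3 (q - p)
        ≤ ∑ _p ∈ Qa, u := Finset.sum_le_sum fun p hp => hu p hp
      _ = Qa.card * u := by rw [Finset.sum_const, nsmul_eq_mul]
  have hT0 : 0 ≤ ∑ c ∈ C, criticalTwoPoint 3 (c.2 - c.1) := Finset.sum_nonneg fun c _ => hG _
  have step : ∑ c ∈ C, ∑ c' ∈ C, criticalCorr 3 4 ![c.1, c.2, c'.1, c'.2] ≤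
      ∑ c ∈ C, ∑ c' ∈ C, (criticalTwoPoint 3 (c.2 - c.1) * criticalTwoPoint 3 (c'.2 - c'.1) +
        criticalTwoPoint 3 (c'.1 - c.1) * criticalTwoPoint 3 (c'.2 - c.2) +
          criticalTwoPoint 3 (c'.2 - c.1) * criticalTwoPoint 3 (c'.1 - c.2)) :=
    Finset.sum_le_sum fun c _ => Finset.sum_le_sum fun c' _ => criticalCorr_four_le_pairings _ _ _ _
  refine step.trans ?_
  simp only [Finset.sum_add_distrib]
  have hT1 : ∑ c ∈ C, ∑ c' ∈ C, criticalTwoPoint 3 (c.2 - c.1) * criticalTwoPoint 3 (c'.2 - c'.1) ≤ (Qa.card * u) ^ 2 := by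
    rw [← Finset.sum_mul_sum, ← sq]
    exact pow_le_pow_left₀ hT0 hT 2
  have hcross : ∀ (f g : Site 3 × Site 3 → Site 3),
      (∀ c ∈ C, (f c ∈ Qa ∨ f c ∈ Qb) ∧ (g c ∈ Qa ∨ g c ∈ Qb)) →
      (∀ c ∈ C, ∑ c' ∈ C, criticalTwoPoint 3 (c'.1 - f c) * criticalTwoPoint 3 (c'.2 - g c) ≤ U * U) := by
    intro f g hfg c hc
    obtain ⟨hf, hg⟩ := hfg c hc
    rw [sum_pairs_eq_sum_fibres Qa Qb C hC (fun c' => criticalTwoPoint 3 (c'.1 - f c) * criticalTwoPoint 3 (c'.2 - g c))]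
    calc ∑ p' ∈ Qa, ∑ q' ∈ Qb.filter (fun q => (p', q) ∈ C), criticalTwoPoint 3 (p' - f c) * criticalTwoPoint 3 (q' - g c)
        ≤ ∑ p' ∈ Qa, ∑ q' ∈ Qb, criticalTwoPoint 3 (p' - f c) * criticalTwoPoint 3 (q' - g c) :=
          Finset.sum_le_sum fun p' _ => Finset.sum_le_sum_of_subset_of_nonneg (Finset.filter_subset _ _)
            fun q' _ _ => mul_nonneg (hG _) (hG _)
      _ = ∑ p' ∈ Qa, criticalTwoPoint 3 (p' - f c) * ∑ q' ∈ Qb, criticalTwoPoint 3 (q' - g c) := by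
          simp only [Finset.mul_sum]
      _ ≤ ∑ p' ∈ Qa, criticalTwoPoint 3 (p' - f c) * U :=
          Finset.sum_le_sum fun p' _ => mul_le_mul_of_nonneg_left (hUb (g c) hg) (hG _)
      _ = (∑ p' ∈ Qa, criticalTwoPoint 3 (p' - f c)) * U := by rw [Finset.sum_mul]
      _ ≤ U * U := mul_le_mul_of_nonneg_right (hUa (f c) hf) hU0
  have hT2 : ∑ c ∈ C, ∑ c' ∈ C, criticalTwoPoint 3 (c'.1 - c.1) * criticalTwoPoint 3 (c'.2 - c.2) ≤ C.card * U ^ 2 := by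
    calc _ ≤ ∑ _c ∈ C, U * U := Finset.sum_le_sum (hcross (fun c => c.1) (fun c => c.2)
          (fun c hc => ⟨Or.inl (hmem c hc).1, Or.inr (hmem c hc).2⟩))
      _ = C.card * U ^ 2 := by rw [Finset.sum_const, nsmul_eq_mul, sq]
  have hT3 : ∑ c ∈ C, ∑ c' ∈ C, criticalTwoPoint 3 (c'.2 - c.1) * criticalTwoPoint 3 (c'.1 - c.2) ≤ C.card * U ^ 2 := by
    have hswap : ∀ c ∈ C, ∑ c' ∈ C, criticalTwoPoint 3 (c'.2 - c.1) * criticalTwoPoint 3 (c'.1 - c.2) =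
        ∑ c' ∈ C, criticalTwoPoint 3 (c'.1 - c.2) * criticalTwoPoint 3 (c'.2 - c.1) :=
      fun c _ => Finset.sum_congr rfl fun c' _ => mul_comm _ _
    rw [Finset.sum_congr rfl hswap]
    calc _ ≤ ∑ _c ∈ C, U * U := Finset.sum_le_sum (hcross (fun c => c.2) (fun c => c.1)
          (fun c hc => ⟨Or.inr (hmem c hc).2, Or.inl (hmem c hc).1⟩))
      _ = C.card * U ^ 2 := by rw [Finset.sum_const, nsmul_eq_mul, sq]
  linarith

/-- **Constrained smeared correlators are small, base points in the cells.** As `constrainedSum_bound`, but the row-sum bound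
`U` is only required for base points lying in the cells `P_{l'}`. [cite: AizenmanDuminilCopinAnnals2021, arXiv:1912.07973 §6.3] -/
theorem constrainedSum_bound' (hNB : NewmanBlocks) {k : ℕ} (P : Fin k → Finset (Site 3)) {a b : Fin k} (hab : a ≠ b)
    (C : Finset (Site 3 × Site 3)) (hC : C ⊆ P a ×ˢ P b) {Λ U u : ℝ} (hU0 : 0 ≤ U) (hu0 : 0 ≤ u)
    (hΛ : ∀ l, ((P l).card : ℝ) ≤ Λ)
    (hUrow : ∀ (l l' : Fin k), ∀ x ∈ P l', ∑ y ∈ P l, criticalTwoPoint 3 (y - x) ≤ U)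
    (hu : ∀ p ∈ P a, ∑ q ∈ (P b).filter (fun q => (p, q) ∈ C), criticalTwoPoint 3 (q - p) ≤ u) :
    ∑ y ∈ (Fintype.piFinset P).filter (fun y => (y a, y b) ∈ C), criticalCorr 3 k y ≤
      Real.sqrt ((Λ * u) ^ 2 + 2 * C.card * U ^ 2) *
        Real.sqrt (((2 * (k - 2)).factorial : ℝ) / (2 ^ (k - 2) * (k - 2).factorial) * (Λ * U) ^ (k - 2)) := by
  -- the plus state
  obtain ⟨μ, hμG, -, hcorr⟩ :=
    exists_plusMeasure_holds (d := 3) (β := criticalBeta 3) (h := (0 : ℝ)) (criticalBeta_nonneg 3)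
  haveI : IsProbabilityMeasure μ := ((mem_isingGibbsMeasures_iff 3 _ 0 μ).1 hμG).isProbabilityMeasure
  have hNBμ := hNB μ hμG
  have hW : ∀ l, ∫ σ, (blockSum (P l) σ) ^ 2 ∂μ ≤ Λ * U := by
    intro l
    rw [integral_blockSum_sq hcorr (P l)]
    calc ∑ x ∈ P l, ∑ y ∈ P l, criticalTwoPoint 3 (y - x) ≤ ∑ _x ∈ P l, U :=
          Finset.sum_le_sum fun x hx => hUrow l l x hx
      _ = (P l).card * U := by rw [Finset.sum_const, nsmul_eq_mul]
      _ ≤ Λ * U := mul_le_mul_of_nonneg_right (hΛ l) hU0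
  have h1 := constrainedSum_le_sqrt_mul_sqrt hcorr hNBμ P hab C hC hW
  have h4 := fourPoint_constrained_le' (P a) (P b) C hC hU0
    (fun x hx => hx.elim (fun h => hUrow a a x h) (fun h => hUrow a b x h))
    (fun x hx => hx.elim (fun h => hUrow b a x h) (fun h => hUrow b b x h)) hu
  refine h1.trans (mul_le_mul_of_nonneg_right (Real.sqrt_le_sqrt (h4.trans ?_)) (Real.sqrt_nonneg _))
  have h : ((P a).card : ℝ) * u ≤ Λ * u := mul_le_mul_of_nonneg_right (hΛ a) hu0
  have h0 : 0 ≤ ((P a).card : ℝ) * u := mul_nonneg (Nat.cast_nonneg _) hu0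
  nlinarith [h, h0]

end Summit.CriticalPhenomena.Ising3DConformalLimit.Cruxes.RotationJoining.RateSplitting

end
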